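import Summits.QuantumFields.YangMills.Theorems.LuscherReductionDressedRitzLiftLeakageStub
import Summits.QuantumFields.YangMills.Theorems.LuscherReductionDressedRitzPolyakovLiftStaticsPrep
import Summits.QuantumFields.YangMills.Theorems.FemtoTransferGapLevelsDecay
import HarnessLib

/-!
# Crux `DressedRitz` (stmt-QuantumFields-20205), line «polyakovlift», stub S-LEAK `stub_liftLeakage` — support IV:
# the `∀`-basis quantifier reduced to ONE reference eigen-ratio family (cluster-constant approximate eigenvalues + in-cluster Gram control)

Support module (fleet seat ym-20205-polyakovlift-s1; `--supports stmt-QuantumFields-20205`, helper, no closure claim).  S-LEAK quantifies over EVERY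
one-site lift basis `LiftBasis (liftCoupling β L) k ω g` — over the labelling AND over all rotations inside exactly degenerate one-site multiplets at
`B₁ = 2/λ³` (the hazard analysed by the crux disprover, `Cruxes/DressedRitz/Disproof.lean` (T2): an equal mixture of two exact eigenvectors
`κ₁ ≠ κ₂` has leakage defect `(κ₁−κ₂)²/4`).  This file proves, at FIXED lattice and with no RG input, that the `∀`-basis residual law follows from
data attached to ONE finite reference family, and pins the proviso as a typed hypothesis:
* §1 (abstract) `residual_sum_le`: if `x_1 … x_M` satisfy `ip(Tx_n,Tx_n) ≤ ρ·ip(x_n,x_n)` and are `γ`-almost orthogonal (`Mγ ≤ 1/2`) on the support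
  of `c`, then `w = Σ c_n x_n` has `ip(Tw,Tw) ≤ 2Mρ·ip(w,w)` (Cauchy–Schwarz twice).
* §2 (fixed lattice) `eq_sum_of_eigen_of_dominating`: an exact physical eigenfunction with eigenvalue `μ > Λ` is the FINITE combination
  `Σ_n ⟨x,ψ_n⟩ψ_n` over any exact orthonormal eigenfamily dominating at level `Λ`, supported on `λ_n = μ` (the remainder is a `μ`-eigenvector
  dominated by `Λ < μ`, hence null, hence zero everywhere by the pointwise eigen-equation); `liftBasis_ground_eq`: the ground state `ω` of ANY lift
  basis IS the positive one-site vacuum (Jentzsch, `PolyakovLift.rawVacuum_eq_smul_of_gap`); `liftVec_sum_smul`: the lift is linear in `g`.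
* §3 ★★ `residualLaw_allBases_of_reference` (+ `exists_reference`: the tree supplies the data): fix `(L, β)`, a physical `φ`, `B > 0`, `k`; `Ω₁ > 0`
  the one-site vacuum at `B`, `ψ_0 … ψ_{N−1}` an exact orthonormal one-site eigenfamily dominating at `Λ < μ_k(B)`, reference lifts
  `v_n = liftVec β φ (ψ_n/Ω₁)`.  IF (RL) `‖K_β v_n − a(λ_n)·v_n‖² ≤ ρ‖v_n‖²` with `a` depending on `n` ONLY THROUGH THE ONE-SITE LEVEL `λ_n`
  (cluster-constant) and (GR) same-level reference lifts are `γ`-almost orthogonal, `Nγ ≤ 1/2`, THEN every lift basis `(ω, g)` at `B` has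
  `∃ a, ‖K_β u_i − a·u_i‖² ≤ 2Nρ‖u_i‖²` (`u = liftFamily β φ g`) — the hypothesis of Part III's `liftLeakage_of_residualLaw`, for ALL bases at once.
  So the `∀`-basis form costs: the residual law for ONE canonical family + CLUSTER-CONSTANCY of the approximate eigenvalue across each exactly
  degenerate one-site level (the disprover's proviso «same-`ε` one-site levels lift into one fine cluster») + the time-0 Gram control (GR) = clause (o2)
  of S-STAT for the reference family.

HONEST FRAMING: fixed-lattice bookkeeping on the conditional femto rung R2b1; (RL) and (GR) are OPEN RG estimates; the stub stays OPEN; nothing here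
bears on infinite volume, the continuum limit or the Clay gap.  References: T. Kato, J. Phys. Soc. Japan 4 (1949) 334 [cite: Kato1949, §1]; Reed–Simon
IV Thm XIII.1, XIII.43–44 [cite: ReedSimonIV1978]; M. Lüscher, NPB 219 (1983) 233 [cite: Luscher1983, §3]; Lüscher–Wolff, NPB 339 (1990) 222
[cite: LuscherWolff1990].
-/

set_option autoImplicit false

noncomputable section

open MeasureTheory Filter Topology Real Finset
open Literature.MathematicalPhysics.QuantumFieldTheory (GaugeConfig Site gaugeTransform)
open Literature.Analysis.OperatorTheory
open scoped BigOperators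

namespace Summit.QuantumFields.YangMills.Theorems.FemtoTransferGap.LiftLeak

open Summit.QuantumFields.YangMills.Theorems.FemtoTransferGap
open Summit.QuantumFields.YangMills.Theorems.FemtoTransferGap.PhysL2
open Summit.QuantumFields.YangMills.Theorems.FemtoTransferGap.PolyakovLift

/-! ## §1 Abstract: residual bounds and almost-orthogonality transfer to finite combinations -/

section Abstract

variable {D : Type*} [AddCommGroup D] [Module ℝ D]

/-- `|B(x,y)| ≤ √B(x,x)·√B(y,y)` for a positive semidefinite symmetric bilinear form. [folklore] -/
theorem abs_bilin_le_sqrt_mul_sqrt (B : D →ₗ[ℝ] D →ₗ[ℝ] ℝ) (hsymm : ∀ x y, B x y = B y x) (hpos : ∀ x, 0 ≤ B x x)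
    (x y : D) : |B x y| ≤ Real.sqrt (B x x) * Real.sqrt (B y y) := by
  rw [← Real.sqrt_mul (hpos x), ← Real.sqrt_sq_eq_abs]
  exact Real.sqrt_le_sqrt (bilin_sq_le B hsymm hpos x y)

/-- `(Σ_n |c_n| s_n)² ≤ M · Σ_n c_n² s_n²` (Cauchy–Schwarz in `ℝ^M`). [folklore] -/
theorem sq_sum_abs_mul_le {M : ℕ} (c s : Fin M → ℝ) :
    (∑ n, |c n| * s n) ^ 2 ≤ (M : ℝ) * ∑ n, c n ^ 2 * s n ^ 2 := by
  have h := Finset.sum_mul_sq_le_sq_mul_sq (Finset.univ : Finset (Fin M)) (fun _ => (1 : ℝ)) (fun n => |c n| * s n)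
  simp only [one_mul, one_pow, Finset.sum_const, Finset.card_univ, Fintype.card_fin, nsmul_eq_mul, mul_one] at h
  exact h.trans (le_of_eq (by congr 1; exact sum_congr rfl fun n _ => by rw [mul_pow, sq_abs]))

/-- ★ **Residual bounds and almost-orthogonality transfer to finite combinations.**  `ip` symmetric positive semidefinite, `T` linear, vectors
`x_1 … x_M`, coefficients `c`.  If on the support of `c`: `ip(Tx_n,Tx_n) ≤ ρ·ip(x_n,x_n)` and `|ip(x_n,x_m)| ≤ γ·√ip(x_n,x_n)√ip(x_m,x_m)` (`n ≠ m`),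
with `ρ, γ ≥ 0` and `Mγ ≤ 1/2`, then `w = Σ_n c_n x_n` satisfies `ip(Tw,Tw) ≤ 2Mρ·ip(w,w)`.  (`ip(Tw,Tw) ≤ (Σ|c_n|‖Tx_n‖)² ≤ Mρ Σc_n²‖x_n‖²` and
`ip(w,w) ≥ (1 − Mγ) Σ c_n²‖x_n‖²`.) [folklore] -/
theorem residual_sum_le (ip : D →ₗ[ℝ] D →ₗ[ℝ] ℝ) (hip : ∀ x y, ip x y = ip y x) (hip0 : ∀ y, 0 ≤ ip y y)
    (T : D →ₗ[ℝ] D) {M : ℕ} (x : Fin M → D) (c : Fin M → ℝ) {ρ γ : ℝ} (hρ : 0 ≤ ρ) (hγ : 0 ≤ γ)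
    (hMγ : (M : ℝ) * γ ≤ 1 / 2)
    (hres : ∀ n, c n ≠ 0 → ip (T (x n)) (T (x n)) ≤ ρ * ip (x n) (x n))
    (hgram : ∀ n m, n ≠ m → c n ≠ 0 → c m ≠ 0 →
      |ip (x n) (x m)| ≤ γ * (Real.sqrt (ip (x n) (x n)) * Real.sqrt (ip (x m) (x m)))) :
    ip (T (∑ n, c n • x n)) (T (∑ n, c n • x n)) ≤ 2 * M * ρ * ip (∑ n, c n • x n) (∑ n, c n • x n) := by
  classical
  set p : Fin M → ℝ := fun n => ip (x n) (x n) with hp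
  set s : Fin M → ℝ := fun n => Real.sqrt (p n) with hs
  set q : Fin M → ℝ := fun n => ip (T (x n)) (T (x n)) with hq
  set S : ℝ := ∑ n, c n ^ 2 * p n with hS
  have hp0 : ∀ n, 0 ≤ p n := fun n => hip0 _
  have hq0 : ∀ n, 0 ≤ q n := fun n => hip0 _
  have hS0 : 0 ≤ S := sum_nonneg fun n _ => mul_nonneg (sq_nonneg _) (hp0 n)
  have hs2 : ∀ n, s n ^ 2 = p n := fun n => Real.sq_sqrt (hp0 n)
  have hTw : T (∑ n, c n • x n) = ∑ n, c n • T (x n) := by simp [map_sum, map_smul]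
  have h1 : ip (T (∑ n, c n • x n)) (T (∑ n, c n • x n)) ≤ (M : ℝ) * ρ * S := by
    rw [hTw, bilin_sum_smul_sum_smul]
    have hterm : ∀ n m, c n * c m * ip (T (x n)) (T (x m)) ≤ (|c n| * Real.sqrt (q n)) * (|c m| * Real.sqrt (q m)) := by
      intro n m
      have hcs := abs_bilin_le_sqrt_mul_sqrt ip hip hip0 (T (x n)) (T (x m))
      calc c n * c m * ip (T (x n)) (T (x m)) ≤ |c n * c m * ip (T (x n)) (T (x m))| := le_abs_self _
        _ = |c n| * |c m| * |ip (T (x n)) (T (x m))| := by rw [abs_mul, abs_mul]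
        _ ≤ |c n| * |c m| * (Real.sqrt (q n) * Real.sqrt (q m)) :=
            mul_le_mul_of_nonneg_left hcs (mul_nonneg (abs_nonneg _) (abs_nonneg _))
        _ = (|c n| * Real.sqrt (q n)) * (|c m| * Real.sqrt (q m)) := by ring
    calc ∑ n, ∑ m, c n * c m * ip (T (x n)) (T (x m))
        ≤ ∑ n, ∑ m, (|c n| * Real.sqrt (q n)) * (|c m| * Real.sqrt (q m)) :=
          sum_le_sum fun n _ => sum_le_sum fun m _ => hterm n m
      _ = (∑ n, |c n| * Real.sqrt (q n)) ^ 2 := by rw [sq, Finset.sum_mul_sum]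
      _ ≤ (M : ℝ) * ∑ n, c n ^ 2 * Real.sqrt (q n) ^ 2 := sq_sum_abs_mul_le c _
      _ = (M : ℝ) * ∑ n, c n ^ 2 * q n := by
          congr 1; exact sum_congr rfl fun n _ => by rw [Real.sq_sqrt (hq0 n)]
      _ ≤ (M : ℝ) * ∑ n, c n ^ 2 * (ρ * p n) := by
          refine mul_le_mul_of_nonneg_left (sum_le_sum fun n _ => ?_) (Nat.cast_nonneg _)
          by_cases hc : c n = 0
          · simp [hc]
          · exact mul_le_mul_of_nonneg_left (hres n hc) (sq_nonneg _)
      _ = (M : ℝ) * ρ * S := by rw [hS, mul_sum, mul_sum]; exact sum_congr rfl fun n _ => by ring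
  have h2 : (1 - (M : ℝ) * γ) * S ≤ ip (∑ n, c n • x n) (∑ n, c n • x n) := by
    rw [bilin_sum_smul_sum_smul]
    have hterm : ∀ n m, c n * c m * (if n = m then p n else 0) - γ * ((|c n| * s n) * (|c m| * s m)) ≤
        c n * c m * ip (x n) (x m) := by
      intro n m
      by_cases hnm : n = m
      · subst hnm
        simp only [if_true, hp]
        nlinarith [mul_nonneg hγ (mul_nonneg (mul_nonneg (abs_nonneg (c n)) (Real.sqrt_nonneg (p n)))
          (mul_nonneg (abs_nonneg (c n)) (Real.sqrt_nonneg (p n))))]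
      · rw [if_neg hnm, mul_zero, zero_sub]
        by_cases hcn : c n = 0
        · simp [hcn]
        by_cases hcm : c m = 0
        · simp [hcm]
        have hg := hgram n m hnm hcn hcm
        have habs : |c n * c m * ip (x n) (x m)| ≤ γ * ((|c n| * s n) * (|c m| * s m)) := by
          rw [abs_mul, abs_mul]
          calc |c n| * |c m| * |ip (x n) (x m)| ≤ |c n| * |c m| * (γ * (Real.sqrt (p n) * Real.sqrt (p m))) :=
                mul_le_mul_of_nonneg_left hg (mul_nonneg (abs_nonneg _) (abs_nonneg _))
            _ = γ * ((|c n| * s n) * (|c m| * s m)) := by simp only [hs]; ring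
        linarith [neg_abs_le (c n * c m * ip (x n) (x m))]
    have hdiag : ∑ n, ∑ m, c n * c m * (if n = m then p n else 0) = S := by
      rw [hS]
      refine sum_congr rfl fun n _ => ?_
      simp only [mul_ite, mul_zero, Finset.sum_ite_eq, Finset.mem_univ, if_true]
      ring
    have hoff : ∑ n, ∑ m, γ * ((|c n| * s n) * (|c m| * s m)) ≤ γ * ((M : ℝ) * S) := by
      rw [show ∑ n, ∑ m, γ * ((|c n| * s n) * (|c m| * s m)) = γ * (∑ n, |c n| * s n) ^ 2 by
        rw [sq, Finset.sum_mul_sum, mul_sum]; exact sum_congr rfl fun n _ => by rw [mul_sum]]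
      refine mul_le_mul_of_nonneg_left ?_ hγ
      calc (∑ n, |c n| * s n) ^ 2 ≤ (M : ℝ) * ∑ n, c n ^ 2 * s n ^ 2 := sq_sum_abs_mul_le c s
        _ = (M : ℝ) * S := by rw [hS]; congr 1; exact sum_congr rfl fun n _ => by rw [hs2 n]
    calc (1 - (M : ℝ) * γ) * S = S - γ * ((M : ℝ) * S) := by ring
      _ ≤ ∑ n, ∑ m, c n * c m * (if n = m then p n else 0) - ∑ n, ∑ m, γ * ((|c n| * s n) * (|c m| * s m)) := by
          rw [hdiag]; linarith [hoff]
      _ = ∑ n, ∑ m, (c n * c m * (if n = m then p n else 0) - γ * ((|c n| * s n) * (|c m| * s m))) := by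
          rw [← Finset.sum_sub_distrib]; exact sum_congr rfl fun n _ => (Finset.sum_sub_distrib _ _).symm
      _ ≤ ∑ n, ∑ m, c n * c m * ip (x n) (x m) := sum_le_sum fun n _ => sum_le_sum fun m _ => hterm n m
  have hS2 : S ≤ 2 * ip (∑ n, c n • x n) (∑ n, c n • x n) := by nlinarith [h2, hMγ, hS0]
  calc ip (T (∑ n, c n • x n)) (T (∑ n, c n • x n)) ≤ (M : ℝ) * ρ * S := h1
    _ ≤ (M : ℝ) * ρ * (2 * ip (∑ n, c n • x n) (∑ n, c n • x n)) :=
        mul_le_mul_of_nonneg_left hS2 (mul_nonneg (Nat.cast_nonneg _) hρ)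
    _ = 2 * M * ρ * ip (∑ n, c n • x n) (∑ n, c n • x n) := by ring

end Abstract

/-! ## §2 Fixed-lattice structure: exact eigenfunctions are finite combinations of a dominating eigenfamily; the lift-basis ground state; linearity -/

section Structure

variable {M : ℕ} [NeZero M]

/-- **An exact physical eigenfunction with eigenvalue above the domination level is a FINITE combination of the dominating eigenfamily.**
`ψ_0 … ψ_{N−1}` physical, `l2`-orthonormal, `K_B ψ_n = λ_n ψ_n`, and every physical `φ ⊥ ψ` has `⟨φ,K_Bφ⟩ ≤ Λ‖φ‖²` (`Λ ≥ 0`); `x` physical with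
`K_B x = μ x` pointwise, `μ > Λ`.  Then `⟨x,ψ_n⟩ = 0` unless `λ_n = μ`, and `x = Σ_n ⟨x,ψ_n⟩ψ_n` EVERYWHERE (the remainder is a `μ`-eigenvector
orthogonal to `ψ`, so `μ‖r‖² ≤ Λ‖r‖²` forces `r = 0` a.e., and `r = μ⁻¹K_B r = 0` pointwise). [cite: ReedSimonIV1978, Thm XIII.1] -/
theorem eq_sum_of_eigen_of_dominating (B : ℝ) {N : ℕ} {ψ : Fin N → (GaugeConfig 3 M SU2 → ℝ)} (hψ : ∀ n, IsPhys (ψ n))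
    (hon : ∀ n m, l2 (ψ n) (ψ m) = if n = m then 1 else 0) (ev : Fin N → ℝ)
    (heig : ∀ n, transferApply B (ψ n) = ev n • ψ n) {Λ : ℝ} (hΛ : 0 ≤ Λ)
    (hdom : ∀ φ : GaugeConfig 3 M SU2 → ℝ, IsPhys φ → (∀ n, l2 φ (ψ n) = 0) → l2 φ (transferApply B φ) ≤ Λ * l2 φ φ)
    {x : GaugeConfig 3 M SU2 → ℝ} (hx : IsPhys x) {μ : ℝ} (hμ : Λ < μ) (hKx : transferApply B x = μ • x) :
    (∀ n, ev n ≠ μ → l2 x (ψ n) = 0) ∧ ∀ U, x U = ∑ n, l2 x (ψ n) * ψ n U := by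
  have hμ0 : 0 < μ := hΛ.trans_lt hμ
  have horth : ∀ n, ev n ≠ μ → l2 x (ψ n) = 0 := by
    intro n hn
    have h1 : l2 (transferApply B x) (ψ n) = μ * l2 x (ψ n) := by rw [hKx, l2_smul_left]
    have h2 : l2 (transferApply B x) (ψ n) = ev n * l2 x (ψ n) := by
      rw [l2_transferApply_comm B hx (hψ n), heig, l2_comm, l2_smul_left, l2_comm]
    have h3 : (μ - ev n) * l2 x (ψ n) = 0 := by rw [sub_mul, ← h1, ← h2, sub_self]
    rcases mul_eq_zero.mp h3 with h | h
    · exact absurd (sub_eq_zero.mp h).symm hn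
    · exact h
  refine ⟨horth, ?_⟩
  set X : physSubmodule M := ⟨x, hx⟩ with hX
  set E : Fin N → physSubmodule M := fun n => ⟨ψ n, hψ n⟩ with hE
  set R : physSubmodule M := X - ∑ n, l2 x (ψ n) • E n with hR
  have hRcoe : ((R : physSubmodule M) : GaugeConfig 3 M SU2 → ℝ) = x - ∑ n, l2 x (ψ n) • ψ n := by
    simp only [hR, hX, hE, Submodule.coe_sub, Submodule.coe_sum, Submodule.coe_smul]
  have hRphys : IsPhys (x - ∑ n, l2 x (ψ n) • ψ n) := by rw [← hRcoe]; exact isPhys_coe R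
  have hRorth : ∀ n, l2 (x - ∑ j, l2 x (ψ j) • ψ j) (ψ n) = 0 := l2_remainder_eq_zero hψ hon hx
  have hEeig : ∀ n, transferOp B (E n) = ev n • E n := fun n => by
    apply Subtype.ext
    simpa only [coe_transferOp, Submodule.coe_smul, hE, Submodule.coe_mk] using heig n
  have hXeig : transferOp B X = μ • X := by
    apply Subtype.ext
    simpa only [coe_transferOp, Submodule.coe_smul, hX, Submodule.coe_mk] using hKx
  have hcoef : ∀ n, l2 x (ψ n) * ev n = μ * l2 x (ψ n) := by
    intro n
    by_cases h : ev n = μ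
    · rw [h, mul_comm]
    · rw [horth n h, zero_mul, mul_zero]
  have hReig : transferOp B R = μ • R := by
    rw [hR, map_sub, map_sum, hXeig, smul_sub, smul_sum]
    congr 1
    refine sum_congr rfl fun n _ => ?_
    rw [map_smul, hEeig n, smul_smul, smul_smul, hcoef n]
  have hKr : transferApply B (x - ∑ n, l2 x (ψ n) • ψ n) = μ • (x - ∑ n, l2 x (ψ n) • ψ n) := by
    have h := congrArg (fun y : physSubmodule M => (y : GaugeConfig 3 M SU2 → ℝ)) hReig
    simpa only [coe_transferOp, Submodule.coe_smul, hRcoe] using h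
  have hdomr := hdom _ hRphys hRorth
  rw [hKr, l2_comm, l2_smul_left, l2_comm] at hdomr
  have hnn : 0 ≤ l2 (x - ∑ n, l2 x (ψ n) • ψ n) (x - ∑ n, l2 x (ψ n) • ψ n) := l2_self_nonneg _
  have hzero : l2 (x - ∑ n, l2 x (ψ n) • ψ n) (x - ∑ n, l2 x (ψ n) • ψ n) = 0 := by nlinarith
  have hae := ae_eq_zero_of_l2_self_eq_zero hRphys hzero
  have hK0 : transferApply B (x - ∑ n, l2 x (ψ n) • ψ n) = 0 := by
    rw [transferApply_congr_ae hae]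
    funext U
    simp [transferApply_apply]
  intro U
  have h := congrArg (fun f => f U) hKr
  simp only [hK0, Pi.zero_apply, Pi.smul_apply, smul_eq_mul] at h
  have hrU : (x - ∑ n, l2 x (ψ n) • ψ n) U = 0 := by
    rcases mul_eq_zero.mp h.symm with h' | h'
    · exact absurd h' hμ0.ne'
    · exact h'
  have : x U - ∑ n, l2 x (ψ n) * ψ n U = 0 := by
    simpa [Finset.sum_apply, Pi.smul_apply, smul_eq_mul] using hrU
  linarith

/-- **The ground state of a lift basis IS the positive one-site vacuum.**  Any `ω` of a `LiftBasis B k ω g` (physical, `ω ≥ c > 0`, `‖ω‖ = 1`,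
`K_Bω = μ₀ω`) coincides EVERYWHERE with any positive raw vacuum `Ω₁` at `B` (Jentzsch: both are `±` the Perron–Frobenius state, and both are
positive). [cite: ReedSimonIV1978, Thm XIII.43 and Thm XIII.44] -/
theorem liftBasis_ground_eq {B : ℝ} {k : ℕ} {ω : GaugeConfig 3 1 SU2 → ℝ} {g : Fin k → (GaugeConfig 3 1 SU2 → ℝ)}
    (hb : LiftBasis B k ω g) {Ω₁ : GaugeConfig 3 1 SU2 → ℝ} (hΩ₁ : IsRawVacuum B Ω₁) (hpos : ∃ c : ℝ, 0 < c ∧ ∀ V, c ≤ Ω₁ V) :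
    ω = Ω₁ := by
  obtain ⟨Ω, θ, c, hΩ, hc, hcle, hn, heigΩ, -, hθ, hgap⟩ := PhysL2.exists_groundState (L := 1) B
  obtain ⟨hωp, ⟨cω, hcω, hcωle⟩, hω1, hωeig, -⟩ := hb
  obtain ⟨hΩ₁p, hΩ₁1, hΩ₁eig⟩ := hΩ₁
  obtain ⟨c₁, hc₁, hc₁le⟩ := hpos
  rw [levelValue_zero] at hωeig hΩ₁eig
  have hω := rawVacuum_eq_smul_of_gap B hωp hωeig hΩ hn heigΩ hθ hgap
  have hΩ₁' := rawVacuum_eq_smul_of_gap B hΩ₁p hΩ₁eig hΩ hn heigΩ hθ hgap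
  have key : ∀ {φ : GaugeConfig 3 1 SU2 → ℝ} {d : ℝ}, 0 < d → (∀ V, d ≤ φ V) → l2 φ φ = 1 →
      (∀ U, φ U = l2 φ Ω * Ω U) → l2 φ Ω = 1 := by
    intro φ d hd hdle hφ1 hmul
    set a : ℝ := l2 φ Ω with ha
    let U₀ : GaugeConfig 3 1 SU2 := fun _ => 1
    have hapos : 0 < a := by
      have h1 : 0 < φ U₀ := hd.trans_le (hdle U₀)
      have h2 : 0 < Ω U₀ := hc.trans_le (hcle U₀)
      rw [hmul U₀] at h1
      exact lt_of_mul_lt_mul_right (by rwa [zero_mul]) h2.le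
    have hfun : φ = a • Ω := funext fun U => by rw [hmul U, Pi.smul_apply, smul_eq_mul]
    have hsq : a * a = 1 := by
      have h := hφ1
      rw [hfun, OpPlat.l2_smul_smul, hn, mul_one] at h
      exact h
    nlinarith
  have haω : l2 ω Ω = 1 := key hcω hcωle hω1 hω
  have haΩ₁ : l2 Ω₁ Ω = 1 := key hc₁ hc₁le hΩ₁1 hΩ₁'
  funext U
  rw [hω U, hΩ₁' U, haω, haΩ₁]

/-- **The lift is linear in the one-site function**: `liftVec β φ (Σ_n c_n f_n) = Σ_n c_n • liftVec β φ f_n` (physical `φ`, `f_n`). [folklore] -/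
theorem liftVec_sum_smul {L : ℕ} [NeZero L] (β : ℝ) {φ : GaugeConfig 3 L SU2 → ℝ} (hφ : IsPhys φ) {N : ℕ}
    {f : Fin N → (GaugeConfig 3 1 SU2 → ℝ)} (hf : ∀ n, IsPhys (f n)) (c : Fin N → ℝ) :
    liftVec β φ (fun V => ∑ n, c n * f n V) = ∑ n, c n • liftVec β φ (f n) := by
  set t : ℝ := flowTime β L with ht
  set Φ : physSubmodule L := ⟨φ, hφ⟩ with hΦ
  set X : Fin N → physSubmodule L := fun n => ⟨flowLiftAt (L := L) 0 t (f n) * φ, OpPlat.isPhys_mul (isPhys_flowLiftAt 0 t (hf n)) hφ⟩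
    with hX
  have hfun : flowLiftAt (L := L) 0 t (fun V => ∑ n, c n * f n V) * φ =
      ((∑ n, c n • X n : physSubmodule L) : GaugeConfig 3 L SU2 → ℝ) := by
    funext U
    simp only [hX, Pi.mul_apply, flowLiftAt, Submodule.coe_sum, Submodule.coe_smul, Finset.sum_apply, Pi.smul_apply,
      smul_eq_mul, Finset.sum_mul]
    exact sum_congr rfl fun n _ => by ring
  have hl2 : l2 φ (flowLiftAt (L := L) 0 t (fun V => ∑ n, c n * f n V) * φ) = ∑ n, c n * l2 φ (flowLiftAt (L := L) 0 t (f n) * φ) := by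
    rw [hfun]
    change l2Form L Φ (∑ n, c n • X n) = _
    rw [map_sum]
    refine sum_congr rfl fun n _ => ?_
    rw [map_smul, smul_eq_mul]
    rfl
  funext U
  simp only [liftVec, OpPlat.ins, ← ht, Pi.mul_apply, Pi.sub_apply, Finset.sum_apply, Pi.smul_apply, smul_eq_mul, hl2]
  simp only [flowLiftAt]
  rw [← Finset.sum_sub_distrib, Finset.sum_mul]
  exact sum_congr rfl fun n _ => by ring

end Structure

/-! ## §3 ★★ The `∀`-basis residual law from ONE reference family -/

section AllBases

variable {L : ℕ} [NeZero L]

/-- ★★ **Residual law for EVERY lift basis from one reference eigen-ratio family.**  Fixed `(L, β)`, a physical `φ` (the vacuum), `B > 0`, `k`.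
Reference data at the one-site coupling `B`: a positive raw vacuum `Ω₁` and an exact physical orthonormal eigenfamily `ψ_0 … ψ_{N−1}` (levels `λ_n`)
dominating at a level `0 ≤ Λ < μ_k(B) = levelValue su2Rep 1 B k`; reference lifts `v_n = liftVec β φ (ψ_n/Ω₁)`.  Hypotheses (the RG content, OPEN):
(RL) `‖K_β v_n − a(λ_n)·v_n‖² ≤ ρ‖v_n‖²` with a CLUSTER-CONSTANT approximate eigenvalue `a(λ_n)`; (GR) `|⟨v_n,v_m⟩| ≤ γ‖v_n‖‖v_m‖` for `n ≠ m`
in the same one-site level, `Nγ ≤ 1/2`.  Conclusion: every lift basis `(ω, g)` at `B` satisfies `∃ a, ‖K_β u_i − a·u_i‖² ≤ 2Nρ·‖u_i‖²`,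
`u = liftFamily β φ g` — the hypothesis shape of `LiftLeak.liftLeakage_of_residualLaw`, for ALL bases at once.  (Each `g_i·ω = g_i·Ω₁` is an exact
eigenfunction with level `μ_{σ(i)+1} ≥ μ_k > Λ`, hence the finite combination `Σ_n ⟨g_iΩ₁,ψ_n⟩ψ_n` supported in ONE level; so `u_i = Σ_n c_n v_n` with
`c` supported in one cluster, and §1 applies with `T = K_β − a(μ)`.) [cite: Luscher1983, §3] [cite: ReedSimonIV1978, Thm XIII.1] [cite: Kato1949, §1] -/
theorem residualLaw_allBases_of_reference (β : ℝ) {φ : GaugeConfig 3 L SU2 → ℝ} (hφ : IsPhys φ) {B : ℝ} (hB : 0 < B) (k : ℕ)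
    {Ω₁ : GaugeConfig 3 1 SU2 → ℝ} (hΩ₁ : IsRawVacuum B Ω₁) (hpos : ∃ c : ℝ, 0 < c ∧ ∀ V, c ≤ Ω₁ V)
    {N : ℕ} {ψ : Fin N → (GaugeConfig 3 1 SU2 → ℝ)} (hψ : ∀ n, IsPhys (ψ n))
    (hon : ∀ n m, l2 (ψ n) (ψ m) = if n = m then 1 else 0) (ev : Fin N → ℝ) (heig : ∀ n, transferApply B (ψ n) = ev n • ψ n)
    {Λ : ℝ} (hΛ : 0 ≤ Λ) (hΛk : Λ < levelValue su2Rep 1 B k)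
    (hdom : ∀ χ : GaugeConfig 3 1 SU2 → ℝ, IsPhys χ → (∀ n, l2 χ (ψ n) = 0) → l2 χ (transferApply B χ) ≤ Λ * l2 χ χ)
    (a : ℝ → ℝ) {ρ γ : ℝ} (hρ : 0 ≤ ρ) (hγ : 0 ≤ γ) (hNγ : (N : ℝ) * γ ≤ 1 / 2)
    (hres : ∀ n, l2 (transferApply β (liftVec β φ (ψ n / Ω₁)) - a (ev n) • liftVec β φ (ψ n / Ω₁))
        (transferApply β (liftVec β φ (ψ n / Ω₁)) - a (ev n) • liftVec β φ (ψ n / Ω₁)) ≤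
      ρ * l2 (liftVec β φ (ψ n / Ω₁)) (liftVec β φ (ψ n / Ω₁)))
    (hgram : ∀ n m, n ≠ m → ev n = ev m →
      |l2 (liftVec β φ (ψ n / Ω₁)) (liftVec β φ (ψ m / Ω₁))| ≤
        γ * (Real.sqrt (l2 (liftVec β φ (ψ n / Ω₁)) (liftVec β φ (ψ n / Ω₁))) *
          Real.sqrt (l2 (liftVec β φ (ψ m / Ω₁)) (liftVec β φ (ψ m / Ω₁)))))
    {ω : GaugeConfig 3 1 SU2 → ℝ} {g : Fin k → (GaugeConfig 3 1 SU2 → ℝ)} (hb : LiftBasis B k ω g) (i : Fin k) :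
    ∃ a' : ℝ, l2 (transferApply β (liftFamily β φ g i) - a' • liftFamily β φ g i)
        (transferApply β (liftFamily β φ g i) - a' • liftFamily β φ g i) ≤
      2 * N * ρ * l2 (liftFamily β φ g i) (liftFamily β φ g i) := by
  classical
  obtain ⟨c₁, hc₁, hc₁le⟩ := hpos
  have hω : ω = Ω₁ := liftBasis_ground_eq hb hΩ₁ ⟨c₁, hc₁, hc₁le⟩
  obtain ⟨hωp, -, -, -, hg, ⟨σ, hσ⟩, hgon⟩ := hb
  set μ : ℝ := levelValue su2Rep 1 B ((σ i : ℕ) + 1) with hμ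
  have hμk : levelValue su2Rep 1 B k ≤ μ := levelValue_le_of_le (L := 1) hB (Nat.succ_le_of_lt (σ i).isLt)
  have hΛμ : Λ < μ := hΛk.trans_le hμk
  have hgω : IsPhys (g i * ω) := OpPlat.isPhys_mul (hg i) hωp
  obtain ⟨hcls, hexp⟩ := eq_sum_of_eigen_of_dominating (M := 1) B hψ hon ev heig hΛ hdom hgω hΛμ (hσ i)
  set c : Fin N → ℝ := fun n => l2 (g i * ω) (ψ n) with hc
  have hf : ∀ n, IsPhys (ψ n / Ω₁) := fun n => OpPlat.isPhys_div (hψ n) hΩ₁.1 hc₁ hc₁le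
  have hgi : g i = fun V => ∑ n, c n * (ψ n / Ω₁) V := by
    funext V
    have hΩV : Ω₁ V ≠ 0 := (hc₁.trans_le (hc₁le V)).ne'
    have h := hexp V
    have hωV : ω V = Ω₁ V := by rw [hω]
    rw [Pi.mul_apply, hωV] at h
    have : g i V = (∑ n, c n * ψ n V) / Ω₁ V := by rw [← h, mul_div_cancel_right₀ _ hΩV]
    rw [this, Finset.sum_div]
    exact sum_congr rfl fun n _ => by rw [Pi.div_apply, mul_div_assoc]
  have hu : liftFamily β φ g i = ∑ n, c n • liftVec β φ (ψ n / Ω₁) := by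
    show liftVec β φ (g i) = _
    rw [hgi, liftVec_sum_smul β hφ hf c]
  set V : Fin N → physSubmodule L := fun n => ⟨liftVec β φ (ψ n / Ω₁), isPhys_liftVec β hφ (hf n)⟩ with hV
  set T : physSubmodule L →ₗ[ℝ] physSubmodule L := transferOp β - a μ • LinearMap.id with hT
  have hTcoe : ∀ y : physSubmodule L, ((T y : physSubmodule L) : GaugeConfig 3 L SU2 → ℝ) =
      transferApply β (y : GaugeConfig 3 L SU2 → ℝ) - a μ • (y : GaugeConfig 3 L SU2 → ℝ) := fun y => by
    simp only [hT, LinearMap.sub_apply, LinearMap.smul_apply, LinearMap.id_apply, Submodule.coe_sub, Submodule.coe_smul,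
      coe_transferOp]
  have hsupp : ∀ n, c n ≠ 0 → ev n = μ := fun n hn => by
    by_contra h; exact hn (hcls n h)
  have hres' : ∀ n, c n ≠ 0 → l2Form L (T (V n)) (T (V n)) ≤ ρ * l2Form L (V n) (V n) := by
    intro n hn
    rw [l2Form_apply, l2Form_apply, hTcoe]
    simpa only [hV, Submodule.coe_mk, hsupp n hn] using hres n
  have hgram' : ∀ n m, n ≠ m → c n ≠ 0 → c m ≠ 0 →
      |l2Form L (V n) (V m)| ≤ γ * (Real.sqrt (l2Form L (V n) (V n)) * Real.sqrt (l2Form L (V m) (V m))) := by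
    intro n m hnm hn hm
    simpa only [l2Form_apply, hV, Submodule.coe_mk] using hgram n m hnm ((hsupp n hn).trans (hsupp m hm).symm)
  have hmain := residual_sum_le (l2Form L) l2Form_symm l2Form_self_nonneg T V c hρ hγ hNγ hres' hgram'
  have hwcoe : ((∑ n, c n • V n : physSubmodule L) : GaugeConfig 3 L SU2 → ℝ) = liftFamily β φ g i := by
    rw [hu]; simp only [Submodule.coe_sum, Submodule.coe_smul, hV]
  refine ⟨a μ, ?_⟩
  rw [l2Form_apply, l2Form_apply, hTcoe, hwcoe] at hmain
  exact hmain

/-- **The tree supplies the reference data** of `residualLaw_allBases_of_reference`: at every one-site coupling `B > 0` and for every `k`, a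
positive raw vacuum `Ω₁` (`PhysL2.exists_groundState` at `L = 1`) and an exact physical orthonormal eigenfamily `ψ_0 … ψ_{N−1}` (levels
`levelValue su2Rep 1 B n`) dominating at `Λ = levelValue su2Rep 1 B N < levelValue su2Rep 1 B k` (`exists_eigenfamily_dominating`; such `N` exists
because the levels tend to `0`, `tendsto_levelValue_atTop_zero`). [cite: ReedSimonIV1978, Thm XIII.1 and Thm XIII.43] -/
theorem exists_reference {B : ℝ} (hB : 0 < B) (k : ℕ) :
    ∃ (Ω₁ : GaugeConfig 3 1 SU2 → ℝ) (N : ℕ) (ψ : Fin N → (GaugeConfig 3 1 SU2 → ℝ)) (Λ : ℝ),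
      IsRawVacuum B Ω₁ ∧ (∃ c : ℝ, 0 < c ∧ ∀ V, c ≤ Ω₁ V) ∧ (∀ n, IsPhys (ψ n)) ∧
      (∀ n m, l2 (ψ n) (ψ m) = if n = m then 1 else 0) ∧
      (∀ n : Fin N, transferApply B (ψ n) = levelValue su2Rep 1 B n • ψ n) ∧
      0 ≤ Λ ∧ Λ < levelValue su2Rep 1 B k ∧
      ∀ χ : GaugeConfig 3 1 SU2 → ℝ, IsPhys χ → (∀ n, l2 χ (ψ n) = 0) → l2 χ (transferApply B χ) ≤ Λ * l2 χ χ := by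
  have hk : 0 < levelValue su2Rep 1 B k := levelValue_su2Rep_pos (L := 1) hB k
  obtain ⟨N, hN⟩ := ((tendsto_levelValue_atTop_zero (L := 1) hB).eventually (gt_mem_nhds hk)).exists
  obtain ⟨ψ, hψ, hon, heig, hdom⟩ := exists_eigenfamily_dominating (L := 1) hB N
  obtain ⟨Ω, θ, c, hΩ, hc, hcle, hn, heigΩ, -, -, -⟩ := exists_groundState (L := 1) B
  exact ⟨Ω, N, ψ, levelValue su2Rep 1 B N, ⟨hΩ, hn, by rw [levelValue_zero]; exact heigΩ⟩, ⟨c, hc, hcle⟩, hψ, hon, heig,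
    levelValue_su2Rep_nonneg 1 hB.le N, hN, hdom⟩

end AllBases

end Summit.QuantumFields.YangMills.Theorems.FemtoTransferGap.LiftLeak

end
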